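import Summits.AtomisticToContinuum.Crystallization.Theorems.FrustratedLawDichotomyTwoShellRigidityCut
import Summits.AtomisticToContinuum.Crystallization.Theorems.FrustratedLawDichotomyTwoShellRigidityDoorTol

/-!
# FrustratedLawDichotomy · crux `AperiodicFrustratedLawGap` (stmt-AtomisticToContinuum-27623) — THE CUT WITH PARAMETERS:
# `G(θ) ∧ P(θ) ∧ M(θ, η) ⟹ KR2(θ, η) ⟹ FDG` for every `0 < θ ≤ 1/100`, `η < 1/20` (decomp-a2c, prover hand 2, gen 9)

`FrustratedLawDichotomyTwoShellRigidityCut` (lens-5 g29 node, p820342) proves the cut `KR2Shape ⟸ G ∧ P ∧ M` only at the registered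
literals `θ = 1/100`, `η < 1/20` (`kr2Shape_of_cut`), although its three pieces `LinkClassification θ`, `CapForcing θ`,
`CappedRigidity θ η` are typed with `θ, η` symbolic.  `FrustratedLawDichotomyTwoShellRigidityDoorTol` (p818040) is the door with
parameters: `Price(θ) ∧ KR2(θ, η) ⟹ FDG` for `0 < θ ≤ 1/100`, `η < 1/20`, where `KR2(θ, η)` is its inline hypothesis `h2`.

This def-free file chains the two for EVERY admissible `(θ, η)` — so the fallback literal `θ = 1/200` (critic rows 401 (3) / 404 (2) /
419 (2)) is served by the SAME three pieces, by name:

* `kr2_of_cut_tol : LinkClassification θ → CapForcing θ → CappedRigidity θ η → KR2(θ, η)` (p818040's `h2`, stated verbatim);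
* `frustrationDensityGap_of_price_of_cut_tol : 0 < θ ≤ 1/100 → η < 1/20 → Price θ → G θ → P θ → M θ η → FDG`;
* by name: `aperiodicFrustratedLawGap_of_price_of_cut_tol` (crux, given `MuEquilibriumDoor`), `aperiodicErgodicGap_of_price_of_cut_tol`
  (the REGISTERED STUB `stub_aperiodicErgodicGap` of skeleton dd3251ad, verbatim), `noFrustratedPeriodicMinimiser_of_price_of_cut_tol`
  (item 26654, door-free);
* `cappedRigidity_antitone_tol : θ₂ ≤ θ → …`-type bookkeeping is NOT available (the bond graph is not monotone in the hypotheses of M), so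
  only the `η`-monotonicity of the node (`cappedRigidity_mono`) is re-exported in use.
`[folklore]` bookkeeping; no definitions, no `sorry`.
-/

noncomputable section

namespace Summit.AtomisticToContinuum.Crystallization.Theorems.FrustratedLawDichotomyTwoShellRigidityCutTol

open Literature.Geometry.DiscreteGeometry
open Literature.MathematicalPhysics.StatisticalMechanics
open Summit.AtomisticToContinuum.Crystallization.Theorems.ChargedEnergyGapNegative (eStar charged)
open Summit.AtomisticToContinuum.Crystallization.Theorems.FrustratedLawDichotomyTwoShellRigidityCut
  (LinkIso LinkClassification CapForcing CappedRigidity)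
open Summit.AtomisticToContinuum.Crystallization.Theorems.FrustratedLawDichotomyTwoShellRigidityDoorTol
  (frustrationDensityGap_of_price_of_kr2 aperiodicFrustratedLawGap_of_price_of_kr2 aperiodicErgodicGap_of_price_of_kr2
    noFrustratedPeriodicMinimiser_of_price_of_kr2)

/-- **THE CUT WITH PARAMETERS.**  For every bond tolerance `θ` and fit tolerance `η`:
`LinkClassification θ ∧ CapForcing θ ∧ CappedRigidity θ η ⟹ KR2(θ, η)`, where `KR2(θ, η)` is the hypothesis `h2` of
`FrustratedLawDichotomyTwoShellRigidityDoorTol.frustrationDensityGap_of_price_of_kr2` VERBATIM (two-shell charge-free(θ) sites have their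
bonded dozen, bijectively pattern-indexed, within `η·nn_i` of `nn_i·A(fcc or hcp pattern)`).  Pure chaining, as `kr2Shape_of_cut`:
G classifies the link of `i` and (two-shell charge-freeness) of each bonded neighbour, P caps it, M fits it within `η' < η ≤ η`. [folklore] -/
theorem kr2_of_cut_tol {θ η : ℝ} (hG : LinkClassification θ) (hP : CapForcing θ) (hM : CappedRigidity θ η) :
    ∀ (N : ℕ) (y : Fin N → EuclideanSpace ℝ (Fin 3)), Function.Injective y → (∀ a b : Fin N, a ≠ b → (7 : ℝ) / 10 ≤ dist (y a) (y b)) → ∀ i : Fin N, Literature.Geometry.DiscreteGeometry.IsChargeFree θ y i → (∀ j : Fin N, (Literature.Geometry.DiscreteGeometry.bondGraph θ y).Adj i j → Literature.Geometry.DiscreteGeometry.IsChargeFree θ y j) → ∃ A : EuclideanSpace ℝ (Fin 3) →ₗᵢ[ℝ] EuclideanSpace ℝ (Fin 3), ((∃ τ : ↥Literature.Geometry.DiscreteGeometry.fccKissingPattern → Fin N, (∀ u : ↥Literature.Geometry.DiscreteGeometry.fccKissingPattern, (Literature.Geometry.DiscreteGeometry.bondGraph θ y).Adj i (τ u)) ∧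 (∀ k : Fin N, (Literature.Geometry.DiscreteGeometry.bondGraph θ y).Adj i k → ∃ u : ↥Literature.Geometry.DiscreteGeometry.fccKissingPattern, τ u = k) ∧ (∀ u : ↥Literature.Geometry.DiscreteGeometry.fccKissingPattern, ‖(y (τ u) - y i) - Literature.Geometry.DiscreteGeometry.nearestDist y i • A (u : EuclideanSpace ℝ (Fin 3))‖ ≤ η * Literature.Geometry.DiscreteGeometry.nearestDist y i)) ∨ (∃ τ : ↥Literature.Geometry.DiscreteGeometry.hcpKissingPattern → Fin N, (∀ u : ↥Literature.Geometry.DiscreteGeometry.hcpKissingPattern, (Literature.Geometry.DiscreteGeometry.bondGraph θ y).Adj i (τ u)) ∧ (∀ k : Fin N, (Literature.Geometry.DiscreteGeometry.bondGraph θ y).Adj i k → ∃ u : ↥Literature.Geometry.DiscreteGeometry.hcpKissingPattern, τ u = k) ∧ (∀ u : ↥Literature.Geometry.DiscreteGeometry.hcpKissingPattern, ‖(y (τ u) - y i) - Literature.Geometry.DiscreteGeometry.nearestDist y i • A (u : EuclideanSpace ℝ (Fin 3))‖ ≤ η * Literature.Geometry.DiscreteGeometry.nearestDist y i))) := by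
  intro N y hy hsep i hcf hcf2
  have hnn : 0 ≤ nearestDist y i := nearestDist_nonneg y i
  have hnb : ∀ j : Fin N, (bondGraph θ y).Adj i j →
      (∃ τ' : ↥fccKissingPattern → Fin N, LinkIso θ fccKissingPattern y j τ') ∨
        (∃ τ' : ↥hcpKissingPattern → Fin N, LinkIso θ hcpKissingPattern y j τ') :=
    fun j hj => hG N y hy hsep j (hcf2 j hj)
  rcases hG N y hy hsep i hcf with ⟨τ, hL⟩ | ⟨τ, hL⟩
  · obtain ⟨η', A, hη', hfit⟩ := hM.1 N y i τ hy hsep hL (hP.1 N y i τ hy hsep hcf hcf2 hL hnb)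
    exact ⟨A, Or.inl ⟨τ, hL.1, hL.2.1, fun u => (hfit u).trans (mul_le_mul_of_nonneg_right hη'.le hnn)⟩⟩
  · obtain ⟨η', A, hη', hfit⟩ := hM.2 N y i τ hy hsep hL (hP.2 N y i τ hy hsep hcf hcf2 hL hnb)
    exact ⟨A, Or.inr ⟨τ, hL.1, hL.2.1, fun u => (hfit u).trans (mul_le_mul_of_nonneg_right hη'.le hnn)⟩⟩

/-- **`Price(θ) ∧ G(θ) ∧ P(θ) ∧ M(θ, η) ⟹ FDG`** for `0 < θ ≤ 1/100`, `η < 1/20` (`κ' = C = κ/30`, through p818040's door).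
`Price θ` = `∃ κ > 0, κ·#charged_θ(y) ≤ U(y) − N·e⋆` (= `ChargedEnergyGap`, item 14231, at `θ = 1/100` by `chargedEnergyGap_iff_price`;
the fallback item at `θ = 1/200`). [folklore] -/
theorem frustrationDensityGap_of_price_of_cut_tol {θ η : ℝ} (hθ0 : 0 < θ) (hθ1 : θ ≤ 1 / 100) (hη : η < 1 / 20)
    (hprice : ∃ κ : ℝ, 0 < κ ∧ ∀ (N : ℕ) (y : Fin N → EuclideanSpace ℝ (Fin 3)), Function.Injective y → κ * (charged θ y : ℝ) ≤ interactionEnergy lennardJones y - (N : ℝ) * eStar)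
    (hG : LinkClassification θ) (hP : CapForcing θ) (hM : CappedRigidity θ η) :
    ∃ κ : ℝ, 0 < κ ∧ ∃ C : ℝ, ∀ (N : ℕ) (y : Fin N → EuclideanSpace ℝ (Fin 3)), Function.Injective y → (∀ a b : Fin N, a ≠ b → (7 : ℝ) / 10 ≤ dist (y a) (y b)) → κ * N - C * (Nat.card {i : Fin N // ∃ (d η γ : ℝ) (A : EuclideanSpace ℝ (Fin 3) →ₗᵢ[ℝ] EuclideanSpace ℝ (Fin 3)), (∃ t : ↥Literature.Geometry.DiscreteGeometry.fccKissingPattern → EuclideanSpace ℝ (Fin 3), 0 < d ∧ 0 < γ ∧ η < 1 / 20 ∧ (∀ u : ↥Literature.Geometry.DiscreteGeometry.fccKissingPattern, t u ∈ (Set.range y) ∧ ‖(t u - (y i)) - d • A (u : EuclideanSpace ℝ (Fin 3))‖ ≤ η * d) ∧ (∀ s : EuclideanSpace ℝ (Fin 3), s ∈ (Set.range y) → s ≠ (y i) → d ≤ dist s (y i)) ∧ (∃ s : EuclideanSpace ℝ (Fin 3), s ∈ (Set.range y) ∧ s ≠ (y i) ∧ dist s (y i) ≤ d) ∧ (∀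 s : EuclideanSpace ℝ (Fin 3), s ∈ (Set.range y) → s ≠ (y i) → dist s (y i) < 13 / 10 * d + γ → dist s (y i) ≤ 13 / 10 * d - γ ∧ s ∈ Set.range t)) ∨ (∃ t : ↥Literature.Geometry.DiscreteGeometry.hcpKissingPattern → EuclideanSpace ℝ (Fin 3), 0 < d ∧ 0 < γ ∧ η < 1 / 20 ∧ (∀ u : ↥Literature.Geometry.DiscreteGeometry.hcpKissingPattern, t u ∈ (Set.range y) ∧ ‖(t u - (y i)) - d • A (u : EuclideanSpace ℝ (Fin 3))‖ ≤ η * d) ∧ (∀ s : EuclideanSpace ℝ (Fin 3), s ∈ (Set.range y) → s ≠ (y i) → d ≤ dist s (y i)) ∧ (∃ s : EuclideanSpace ℝ (Fin 3), s ∈ (Set.range y) ∧ s ≠ (y i) ∧ dist s (y i) ≤ d) ∧ (∀ s : EuclideanSpace ℝ (Fin 3), s ∈ (Set.range y) → s ≠ (y i) → dist s (y i) < 13 / 10 * d + γ → dist s (y i) ≤ 13 / 10 * d - γ ∧ s ∈ Set.range t))} : ℝ) ≤ Literature.MathematicalPhysics.StatisticalMechanics.interactionEnergy Literature.MathematicalPhysics.StatisticalMechanics.lennardJones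 y - N * (⨅ Q : Literature.MathematicalPhysics.StatisticalMechanics.PeriodicConfiguration 3, Q.energyPerParticle Literature.MathematicalPhysics.StatisticalMechanics.lennardJones) :=
  frustrationDensityGap_of_price_of_kr2 hθ0 hθ1 hη hprice (kr2_of_cut_tol hG hP hM)

/-- **`AperiodicFrustratedLawGap` (crux of item 27623) BY NAME from `MuEquilibriumDoor ∧ Price(θ) ∧ G(θ) ∧ P(θ) ∧ M(θ, η)`**,
`0 < θ ≤ 1/100`, `η < 1/20`. [folklore] -/
theorem aperiodicFrustratedLawGap_of_price_of_cut_tol {θ η : ℝ} (hθ0 : 0 < θ) (hθ1 : θ ≤ 1 / 100) (hη : η < 1 / 20)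
    (hDoor : Summit.AtomisticToContinuum.Crystallization.Theses.GrainCoreNetworkSplit.MuEquilibriumDoor)
    (hprice : ∃ κ : ℝ, 0 < κ ∧ ∀ (N : ℕ) (y : Fin N → EuclideanSpace ℝ (Fin 3)), Function.Injective y → κ * (charged θ y : ℝ) ≤ interactionEnergy lennardJones y - (N : ℝ) * eStar)
    (hG : LinkClassification θ) (hP : CapForcing θ) (hM : CappedRigidity θ η) :
    Summit.AtomisticToContinuum.Crystallization.Theses.FrustratedLawDichotomy.AperiodicFrustratedLawGap :=
  aperiodicFrustratedLawGap_of_price_of_kr2 hθ0 hθ1 hη hDoor hprice (kr2_of_cut_tol hG hP hM)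

/-- **The REGISTERED STUB `stub_aperiodicErgodicGap` (skeleton dd3251ad), verbatim, from
`MuEquilibriumDoor ∧ Price(θ) ∧ G(θ) ∧ P(θ) ∧ M(θ, η)`**, `0 < θ ≤ 1/100`, `η < 1/20`. [folklore] -/
theorem aperiodicErgodicGap_of_price_of_cut_tol {θ η : ℝ} (hθ0 : 0 < θ) (hθ1 : θ ≤ 1 / 100) (hη : η < 1 / 20)
    (hDoor : Summit.AtomisticToContinuum.Crystallization.Theses.GrainCoreNetworkSplit.MuEquilibriumDoor)
    (hprice : ∃ κ : ℝ, 0 < κ ∧ ∀ (N : ℕ) (y : Fin N → EuclideanSpace ℝ (Fin 3)), Function.Injective y → κ * (charged θ y : ℝ) ≤ interactionEnergy lennardJones y - (N : ℝ) * eStar)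
    (hG : LinkClassification θ) (hP : CapForcing θ) (hM : CappedRigidity θ η) :
    ∀ δ : ℝ, 0 < δ → ∀ P : MeasureTheory.Measure (MeasureTheory.Measure (EuclideanSpace ℝ (Fin 3))), let Gy : ℝ → (N : ℕ) → (Fin N → EuclideanSpace ℝ (Fin 3)) → Fin N → Prop := fun η N y j => let d : ℝ := sInf ((fun z => dist z (y (j : Fin N))) '' (Set.range (y) \ {(y (j : Fin N))})); let T : Set (EuclideanSpace ℝ (Fin 3)) := {z : EuclideanSpace ℝ (Fin 3) | z ∈ Set.range (y) ∧ z ≠ (y (j : Fin N)) ∧ dist z (y (j : Fin N)) < 13 / 10 * d}; ∃ A : EuclideanSpace ℝ (Fin 3) →ₗᵢ[ℝ] EuclideanSpace ℝ (Fin 3), (∃ e : ↥T ≃ ↥Literature.Geometry.DiscreteGeometry.fccKissingPattern, ∀ t : ↥T, dist (d⁻¹ • ((t : EuclideanSpace ℝ (Fin 3)) - (y (j : Fin N)))) (A ((e t : ↥Literature.Geometry.DiscreteGeometry.fccKissingPattern) : EuclideanSpace ℝ (Fin 3))) ≤ η) ∨ (∃ e : ↥T ≃ ↥Literature.Geometry.DiscreteGeometry.hcpKissingPattern,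 ∀ t : ↥T, dist (d⁻¹ • ((t : EuclideanSpace ℝ (Fin 3)) - (y (j : Fin N)))) (A ((e t : ↥Literature.Geometry.DiscreteGeometry.hcpKissingPattern) : EuclideanSpace ℝ (Fin 3))) ≤ η); let TexBall : (N : ℕ) → (Fin N → EuclideanSpace ℝ (Fin 3)) → Fin N → ℝ → ℝ → ℝ → ℝ → Prop := fun N y i R R₇ R₈ R₉ => (∀ a b : Fin N, a ≠ b → (7 : ℝ) / 10 ≤ dist (y a) (y b)) ∧ (∀ j : Fin N, dist (y j) (y i) ≤ R → ¬ Gy (1 / 20) N (y) j) ∧ (∀ j : Fin N, dist (y j) (y i) ≤ R → ¬ ((∀ j' : Fin N, dist (y j') (y j) ≤ R₇ → ¬ Gy (1 / 20) N (y) j') ∧ (∀ z : EuclideanSpace ℝ (Fin 3), dist z (y j) ≤ R₇ → ∃ k : Fin N, dist z (y k) ≤ 1) ∧ (∀ j' : Fin N, dist (y j') (y j) ≤ R₇ → (let d : ℝ := sInf ((fun z => dist z (y j')) '' (Set.range (y) \ {(y j')})); ∀ k : Fin N, y k ≠ y j' → dist (y k) (y j') < 27 / 20 * d → 5 ≤ Nat.card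 {m : Fin N // y m ≠ y j' ∧ dist (y m) (y j') < 27 / 20 * d ∧ y m ≠ y k ∧ dist (y m) (y k) < 27 / 20 * d})))) ∧ (∀ j : Fin N, dist (y j) (y i) ≤ R → ∃ k : Fin N, dist (y k) (y j) ≤ R₈ ∧ Gy (1 / 8) N (y) k) ∧ (∀ j : Fin N, dist (y j) (y i) ≤ R → ¬ ((∀ j' : Fin N, dist (y j') (y j) ≤ R₉ → ¬ Gy (1 / 20) N (y) j') ∧ (Nat.card {j' : Fin N // dist (y j') (y j) ≤ R₉ ∧ ¬ Gy (1 / 8) N (y) j'} : ℝ) ≤ 1 / 2 * (Nat.card {j' : Fin N // dist (y j') (y j) ≤ R₉} : ℝ) ∧ (∀ j' : Fin N, dist (y j') (y j) ≤ R₉ → ¬ Gy (1 / 8) N (y) j' → ¬ (let d : ℝ := sInf ((fun z => dist z (y j')) '' (Set.range (y) \ {(y j')})); ∀ k : Fin N, y k ≠ y j' → dist (y k) (y j') < 27 / 20 * d → 5 ≤ Nat.card {m : Fin N // y m ≠ y j' ∧ dist (y m) (y j') < 27 / 20 * d ∧ y m ≠ y k ∧ dist (y m) (y k) < 27 / 20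 * d})))); let Appr : MeasureTheory.Measure (EuclideanSpace ℝ (Fin 3)) → ℝ → ℝ → ℝ → Prop := fun μ R₇ R₈ R₉ => ∀ q : EuclideanSpace ℝ (Fin 3), μ {q} ≠ 0 → ∀ R ε : ℝ, 0 < ε → ∃ (N : ℕ) (y : Fin N → EuclideanSpace ℝ (Fin 3)) (i : Fin N), TexBall N y i R R₇ R₈ R₉ ∧ (∀ p : EuclideanSpace ℝ (Fin 3), μ {p} ≠ 0 → dist p q ≤ R → ∃ k : Fin N, dist (y k - y i) (p - q) ≤ ε) ∧ (∀ k : Fin N, dist (y k) (y i) ≤ R → ∃ p : EuclideanSpace ℝ (Fin 3), μ {p} ≠ 0 ∧ dist (y k - y i) (p - q) ≤ ε); MeasureTheory.IsProbabilityMeasure P → (∀ᵐ μ ∂P, Literature.Probability.Process.IsRootedHardCore δ μ) → Literature.Probability.Process.IsPointStationaryLaw P → (∃ R₇ R₈ R₉ : ℝ, ∀ᵐ μ ∂P, Appr μ R₇ R₈ R₉) → (∀ᵐ μ ∂P, ∀ p : EuclideanSpace ℝ (Fin 3), μ {p} ≠ 0 → ∀ y : EuclideanSpace ℝ (Fin 3),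 (∀ q : EuclideanSpace ℝ (Fin 3), μ {q} ≠ 0 → q ≠ p → y ≠ q) → ∑' q : {q : EuclideanSpace ℝ (Fin 3) // μ {q} ≠ 0 ∧ q ≠ p}, Literature.MathematicalPhysics.StatisticalMechanics.lennardJones (dist p (q : EuclideanSpace ℝ (Fin 3))) ≤ ∑' q : {q : EuclideanSpace ℝ (Fin 3) // μ {q} ≠ 0 ∧ q ≠ p}, Literature.MathematicalPhysics.StatisticalMechanics.lennardJones (dist y (q : EuclideanSpace ℝ (Fin 3)))) → P {μ : MeasureTheory.Measure (EuclideanSpace ℝ (Fin 3)) | ∃ Q : Literature.MathematicalPhysics.StatisticalMechanics.PeriodicConfiguration 3, ∃ t : EuclideanSpace ℝ (Fin 3), {p : EuclideanSpace ℝ (Fin 3) | μ {p} ≠ 0} = (fun s => s + t) '' Q.points} = 0 → (∀ A : Set (MeasureTheory.Measure (EuclideanSpace ℝ (Fin 3))), MeasurableSet A → (∀ μ : MeasureTheory.Measure (EuclideanSpace ℝ (Fin 3)), ∀ p : EuclideanSpace ℝ (Fin 3), μ {p} ≠ 0 → (μ ∈ A ↔ MeasureTheory.Measure.map (fun z : EuclideanSpace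 ℝ (Fin 3) => z - p) μ ∈ A)) → P A = 0 ∨ P Aᶜ = 0) → (⨅ Q : Literature.MathematicalPhysics.StatisticalMechanics.PeriodicConfiguration 3, Q.energyPerParticle Literature.MathematicalPhysics.StatisticalMechanics.lennardJones) < (∫ μ, Literature.MathematicalPhysics.StatisticalMechanics.rootEnergy Literature.MathematicalPhysics.StatisticalMechanics.lennardJones μ ∂P) :=
  aperiodicErgodicGap_of_price_of_kr2 hθ0 hθ1 hη hDoor hprice (kr2_of_cut_tol hG hP hM)

/-- **`NoFrustratedPeriodicMinimiser` (item 26654) from `Price(θ) ∧ G(θ) ∧ P(θ) ∧ M(θ, η)`, DOOR-FREE**, `0 < θ ≤ 1/100`, `η < 1/20`.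
[folklore] -/
theorem noFrustratedPeriodicMinimiser_of_price_of_cut_tol {θ η : ℝ} (hθ0 : 0 < θ) (hθ1 : θ ≤ 1 / 100) (hη : η < 1 / 20)
    (hprice : ∃ κ : ℝ, 0 < κ ∧ ∀ (N : ℕ) (y : Fin N → EuclideanSpace ℝ (Fin 3)), Function.Injective y → κ * (charged θ y : ℝ) ≤ interactionEnergy lennardJones y - (N : ℝ) * eStar)
    (hG : LinkClassification θ) (hP : CapForcing θ) (hM : CappedRigidity θ η) :
    Summit.AtomisticToContinuum.Crystallization.Theses.PeriodicChargeSplit.NoFrustratedPeriodicMinimiser :=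
  noFrustratedPeriodicMinimiser_of_price_of_kr2 hθ0 hθ1 hη hprice (kr2_of_cut_tol hG hP hM)

/-- **The fallback literal `θ = 1/200`, by name**: `Price(1/200) ∧ G(1/200) ∧ P(1/200) ∧ M(1/200, η)`, `η < 1/20`, `MuEquilibriumDoor`
⟹ `AperiodicFrustratedLawGap`. [folklore] -/
theorem aperiodicFrustratedLawGap_of_price_of_cut_200 {η : ℝ} (hη : η < 1 / 20)
    (hDoor : Summit.AtomisticToContinuum.Crystallization.Theses.GrainCoreNetworkSplit.MuEquilibriumDoor)
    (hprice : ∃ κ : ℝ, 0 < κ ∧ ∀ (N : ℕ) (y : Fin N → EuclideanSpace ℝ (Fin 3)), Function.Injective y → κ * (charged (1 / 200 : ℝ) y : ℝ) ≤ interactionEnergy lennardJones y - (N : ℝ) * eStar)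
    (hG : LinkClassification (1 / 200)) (hP : CapForcing (1 / 200)) (hM : CappedRigidity (1 / 200) η) :
    Summit.AtomisticToContinuum.Crystallization.Theses.FrustratedLawDichotomy.AperiodicFrustratedLawGap :=
  aperiodicFrustratedLawGap_of_price_of_cut_tol (by norm_num) (by norm_num) hη hDoor hprice hG hP hM

end Summit.AtomisticToContinuum.Crystallization.Theorems.FrustratedLawDichotomyTwoShellRigidityCutTol

end
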